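import Literature.AlgebraicGeometry.Modules.UnitCocyclePresented
import Mathlib.AlgebraicGeometry.Morphisms.ClosedImmersion
import Mathlib.AlgebraicGeometry.Morphisms.QuasiCompact
import Mathlib.Dynamics.Newton
import HarnessLib

/-!
# Unipotent `n`-th roots, the nil kernel of a surjective closed immersion, and Čech `1`-cocycles of units reducing to `1`
# on a nilpotent thickening

Layer `Literature/AlgebraicGeometry/Modules`, namespace `Literature.AlgebraicGeometry.Modules`.  THEOREMS ONLY (no definition,
no named fact, no instance, no notation, no `sorry`).  Cell `hodgecm-mathlib` (D-0151), F-3 sub-line `Cruxes/HDel/Lines/F3DualAbelianScheme`,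
stub (K) `stub_F3K`, road T brick (T2) — FILE A of two (B = `Modules/CechPicTorsionThickening`, the torsion-rigidity theorem); census
`B-provers/B-p03/g20/F3K/CENSUS-F3K-TorsionRoad.B-p03g20.md` (B-p03 (g20); B-plan1 (g19) words 2026-08-30 19:04:10Z / 19:15:48Z).
HC_CM is proved only modulo the 7 printed citations until rung 0 closes; nothing here is about HC.

SETTING.  `i : X ⟶ X'` a SURJECTIVE CLOSED IMMERSION of schemes (a nilpotent thickening, e.g. `A ×_R Spec κ ↪ A ×_R Spec R'` for an Artin
local ring `R'` with residue field `κ`); classes in the tree's Čech Picard group `Modules.CechPic X' = Ȟ¹(X', 𝒪^×)` represented by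
point-indexed unit cocycles `Modules.UnitCocycle` ([Hartshorne1977] III §4, Ex. 4.4–4.5).

* §1 UNIPOTENT `n`-TH ROOTS (commutative algebra; both from Mathlib's Newton–Raphson lemma
  `Polynomial.existsUnique_nilpotent_sub_and_aeval_eq_zero` for `P = X^n − u`): in a commutative ring in which `n` is a unit, `x ↦ x^n` is
  INJECTIVE on each coset «unit + nilpotent» (`eq_of_pow_eq_pow_of_isNilpotent_sub`) and every `u ≡ 1 (mod nilpotents)` has an `n`-th root
  `r ≡ 1` (`exists_pow_eq_of_isNilpotent_sub_one`).  [cite: AtiyahMacdonald1969, Ch. 10 Ex. 9 (Hensel's lemma) and Prop. 1.9 (units + nilradical)]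
* §2 the kernel of `i♯` on a quasi-compact (e.g. affine) open is NIL for `i` surjective (`isNilpotent_of_app_eq_zero`: `i⁻¹(D(s)) = D(i♯s) = ∅`
  forces `D(s) = ∅`; Mathlib `Scheme.isNilpotent_iff_basicOpen_eq_bot_of_isCompact`); privately: opens of `X` are preimages of opens of `X'`,
  affine refinements, lifts of units over affine opens are units.  [cite: Hartshorne2010, §2 p. 11 and §6 proof of Thm. 6.4 (p. 50)]
* §3 **`UnitCocycle.exists_app_eq_one_of_pullback_eq_one`** — a class `[G]` with `i^*[G] = 1` is represented, on affine charts, by a cocycle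
  whose transition functions REDUCE TO `1` under `i♯` (`i♯G_{xy} = 1` over every open below the charts): the coboundary `λ_y = λ_x · i♯G_{xy}`
  on `X` has its units lifted over affine charts of `X'` (onto there; lifts of units are units) and `G` is twisted by the lifts — the
  cochain-level style of ★ `Deformation/UnitCocycleLiftingCharZero.UnitCocycle.exists_refines_pullback` (Mumford's «lift `Ḡ_ij` arbitrarily to
  `G_ij`»), here for the KERNEL of `i^*` instead of its image.  [cite: Hartshorne1977, III §4, Ex. 4.4–4.5]
  [cite: Hartshorne2010, §6 proof of Thm. 6.4 (p. 50)]

## References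
* [Hartshorne1977] R. Hartshorne, *Algebraic Geometry*, GTM 52 (1977), III §4, Ex. III.4.4–4.6.
* [Hartshorne2010] R. Hartshorne, *Deformation Theory*, GTM 257 (2010), §2 (p. 11), §6 Thm. 6.4 (pp. 50–51).
* [AtiyahMacdonald1969] M. F. Atiyah, I. G. Macdonald, *Introduction to Commutative Algebra* (1969), Prop. 1.9, Ch. 10 Ex. 9.
-/

noncomputable section

universe u

open CategoryTheory AlgebraicGeometry Opposite TopologicalSpace Polynomial

namespace Literature.AlgebraicGeometry.Modules

/-! ## §1 Unipotent `n`-th roots in a commutative ring with `n` invertible -/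

section Roots

variable {R : Type*} [CommRing R] {n : ℕ}

/-- `P = X^n − c` evaluates at `x` to `x^n − c` and its derivative to `n x^{n-1}`. [folklore] -/
private theorem aeval_X_pow_sub_C (c x : R) :
    aeval x ((X : R[X]) ^ n - C c) = x ^ n - c ∧ aeval x (derivative ((X : R[X]) ^ n - C c)) = (n : R) * x ^ (n - 1) := by
  constructor
  · rw [map_sub, aeval_X_pow, aeval_C, Algebra.algebraMap_self, RingHom.id_apply]
  · rw [derivative_sub, derivative_X_pow, derivative_C, sub_zero, map_mul, aeval_C, aeval_X_pow, Algebra.algebraMap_self,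
      RingHom.id_apply]

/-- **`x ↦ x^n` is injective on «unit + nilpotent» when `n` is a unit**: if `y` is a unit, `x − y` is nilpotent and `x^n = y^n`, then
`x = y` (uniqueness in Mathlib's Newton–Raphson lemma for `P = X^n − y^n` at the approximate root `y`; directly: `(1+d)^n − 1 = d(n + d k)`
with `n + d k` a unit). [cite: AtiyahMacdonald1969, Prop. 1.9 and Ch. 10 Ex. 9] -/
theorem eq_of_pow_eq_pow_of_isNilpotent_sub (hn : IsUnit (n : R)) {x y : R} (hy : IsUnit y) (hxy : IsNilpotent (x - y))
    (h : x ^ n = y ^ n) : x = y := by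
  obtain ⟨hP, hP'⟩ := aeval_X_pow_sub_C (n := n) (y ^ n) y
  have h0 : IsNilpotent (aeval y ((X : R[X]) ^ n - C (y ^ n))) := by rw [hP, sub_self]; exact IsNilpotent.zero
  have h1 : IsUnit (aeval y (derivative ((X : R[X]) ^ n - C (y ^ n)))) := by rw [hP']; exact hn.mul (hy.pow _)
  obtain ⟨r, -, hr⟩ := existsUnique_nilpotent_sub_and_aeval_eq_zero h0 h1
  have hx' : IsNilpotent (y - x) ∧ aeval x ((X : R[X]) ^ n - C (y ^ n)) = 0 := by
    refine ⟨?_, ?_⟩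
    · rw [← neg_sub]; exact hxy.neg
    · rw [(aeval_X_pow_sub_C (n := n) (y ^ n) x).1, h, sub_self]
  have hy' : IsNilpotent (y - y) ∧ aeval y ((X : R[X]) ^ n - C (y ^ n)) = 0 := by
    refine ⟨by rw [sub_self]; exact IsNilpotent.zero, ?_⟩
    rw [hP, sub_self]
  exact (hr x hx').trans (hr y hy').symm

/-- **Unipotent elements have unipotent `n`-th roots when `n` is a unit**: if `u − 1` is nilpotent there is `r` with `r − 1` nilpotent and
`r^n = u` (existence in Mathlib's Newton–Raphson lemma `Polynomial.existsUnique_nilpotent_sub_and_aeval_eq_zero` for `P = X^n − u` at the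
approximate root `1`: `P(1) = 1 − u` is nilpotent and `P'(1) = n` is a unit). [cite: AtiyahMacdonald1969, Ch. 10 Ex. 9 (Hensel's lemma)] -/
theorem exists_pow_eq_of_isNilpotent_sub_one (hn : IsUnit (n : R)) {u : R} (hu : IsNilpotent (u - 1)) :
    ∃ r : R, IsNilpotent (r - 1) ∧ r ^ n = u := by
  obtain ⟨hP, hP'⟩ := aeval_X_pow_sub_C (n := n) u (1 : R)
  have h0 : IsNilpotent (aeval (1 : R) ((X : R[X]) ^ n - C u)) := by
    rw [hP, one_pow, ← neg_sub]; exact hu.neg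
  have h1 : IsUnit (aeval (1 : R) (derivative ((X : R[X]) ^ n - C u))) := by rw [hP', one_pow, mul_one]; exact hn
  obtain ⟨r, ⟨hr1, hr⟩, -⟩ := existsUnique_nilpotent_sub_and_aeval_eq_zero h0 h1
  refine ⟨r, by rw [← neg_sub]; exact hr1.neg, ?_⟩
  rwa [(aeval_X_pow_sub_C (n := n) u r).1, sub_eq_zero] at hr

end Roots

/-! ## §2 A surjective closed immersion: nil kernel on quasi-compact opens, opens as preimages, lifts of units -/

section Thickening

variable {X X' : Scheme.{u}} (i : X ⟶ X') [IsClosedImmersion i]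

omit [IsClosedImmersion i] in
/-- **The kernel of `i♯` on a quasi-compact open is nil** for a SURJECTIVE morphism `i`: if `i♯(s) = 0` on `i⁻¹U` then the basic open
`D(s) ⊆ U` has empty preimage `D(i♯ s) = D(0)`, hence is empty, so `s` is nilpotent (Mathlib `Scheme.isNilpotent_iff_basicOpen_eq_bot_of_isCompact`).
[cite: Hartshorne2010, §6 proof of Thm. 6.4, p. 50 (`0 → J ⊗ 𝒪_X → 𝒪_{X'} → 𝒪_X → 0`, `J` nilpotent)]
[cite: AtiyahMacdonald1969, Prop. 1.8 (nilradical = ⋂ primes)] -/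
theorem isNilpotent_of_app_eq_zero [Surjective i] {U : X'.Opens} (hU : IsCompact (U : Set X')) {s : Γ(X', U)}
    (hs : i.app U s = 0) : IsNilpotent s := by
  rw [Scheme.isNilpotent_iff_basicOpen_eq_bot_of_isCompact hU]
  refine le_bot_iff.1 fun p hp => ?_
  obtain ⟨x, rfl⟩ := i.surjective p
  have hx : x ∈ i ⁻¹ᵁ X'.basicOpen s := hp
  rw [Scheme.preimage_basicOpen, hs, Scheme.basicOpen_zero] at hx
  exact hx

omit [IsClosedImmersion i] in
/-- The same over an affine open (affine opens are quasi-compact). [cite: Hartshorne2010, §6 proof of Thm. 6.4, p. 50] -/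
theorem isNilpotent_of_app_eq_zero_of_isAffineOpen [Surjective i] {U : X'.Opens} (hU : IsAffineOpen U) {s : Γ(X', U)}
    (hs : i.app U s = 0) : IsNilpotent s :=
  isNilpotent_of_app_eq_zero i hU.isCompact hs

/-- Along a closed immersion every open of the source is the preimage of an open of the target (a closed immersion is a topological
embedding). [cite: Hartshorne2010, §2 p. 11] -/
private theorem exists_preimage_eq (W : X.Opens) : ∃ W' : X'.Opens, i ⁻¹ᵁ W' = W := by
  refine ⟨⟨(i.base '' (W : Set X)ᶜ)ᶜ, (i.isClosedEmbedding.isClosedMap _ W.2.isClosed_compl).isOpen_compl⟩, ?_⟩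
  ext x
  change i.base x ∈ (i.base '' (W : Set X)ᶜ)ᶜ ↔ x ∈ (W : Set X)
  rw [Set.mem_compl_iff, i.isClosedEmbedding.injective.mem_set_image, Set.mem_compl_iff, not_not]

/-- Affine refinement across a closed immersion: for `x ∈ W ⊆ X` open and `i(x) ∈ U' ⊆ X'` open there is an affine open `A ∋ i(x)` of `X'`
inside `U'` with `i⁻¹(A) ⊆ W`. [cite: Hartshorne1977, III §4 Ex. 4.4 (refinements)] -/
private theorem exists_affineOpens_preimage_le {x : X} {W : X.Opens} (hx : x ∈ W) {U' : X'.Opens} (hx' : i.base x ∈ U') :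
    ∃ A : X'.affineOpens, i.base x ∈ A.1 ∧ A.1 ≤ U' ∧ i ⁻¹ᵁ A.1 ≤ W := by
  obtain ⟨W', hW'⟩ := exists_preimage_eq i W
  have hxW' : i.base x ∈ W' ⊓ U' := by
    refine ⟨?_, hx'⟩
    have hx2 : x ∈ i ⁻¹ᵁ W' := by rw [hW']; exact hx
    exact hx2
  obtain ⟨A, hA, hxA, hAle⟩ := (Opens.isBasis_iff_nbhd.mp X'.isBasis_affineOpens) hxW'
  refine ⟨⟨A, hA⟩, hxA, hAle.trans inf_le_right, fun y hy => ?_⟩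
  have hy' : y ∈ i ⁻¹ᵁ W' := (hAle.trans inf_le_left) hy
  rw [hW'] at hy'
  exact hy'

/-- **Lifts of units are units** along a surjective closed immersion, over an affine open: if `i♯(s)` is a unit so is `s` (lift an inverse —
`i♯` is onto over affine opens — and `s t = 1 +` nilpotent). [cite: Hartshorne2010, §6 proof of Thm. 6.4, p. 50] -/
private theorem isUnit_of_isUnit_app [Surjective i] {U : X'.Opens} (hU : IsAffineOpen U) {s : Γ(X', U)} (hs : IsUnit (i.app U s)) :
    IsUnit s := by
  obtain ⟨tbar, htbar⟩ := hs.exists_right_inv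
  obtain ⟨t, rfl⟩ := i.app_surjective U hU tbar
  have h0 : i.app U (s * t - 1) = 0 := by rw [map_sub, map_mul, map_one, htbar, sub_self]
  have h1 : IsUnit (s * t) := by
    have h2 := (isNilpotent_of_app_eq_zero_of_isAffineOpen i hU h0).isUnit_one_add
    rwa [add_sub_cancel] at h2
  exact isUnit_of_mul_isUnit_left h1

end Thickening

/-! ## §3 A class killed by `i^*` is represented by a cocycle reducing to `1` under `i♯` -/

section Reduction

variable {X X' : Scheme.{u}} (i : X ⟶ X') [IsClosedImmersion i] [Surjective i]

/-- The units of a coboundary only depend on the point up to equality (transport along `σ (i x) = x`). [folklore] -/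
private theorem Coboundary.lam_congr_point {Y : Scheme.{u}} {c c' : UnitCocycle Y} (b : UnitCocycle.Coboundary c c') {x₁ x₂ : Y}
    (e : x₁ = x₂) (V : Y.Opens) (h₁ : V ≤ b.W x₁) (h₂ : V ≤ b.W x₂) : b.lam x₁ V h₁ = b.lam x₂ V h₂ := by
  subst e; rfl

/-- The inverses of a coboundary only depend on the point up to equality. [folklore] -/
private theorem Coboundary.inv_congr_point {Y : Scheme.{u}} {c c' : UnitCocycle Y} (b : UnitCocycle.Coboundary c c') {x₁ x₂ : Y}
    (e : x₁ = x₂) (V : Y.Opens) (h₁ : V ≤ b.W x₁) (h₂ : V ≤ b.W x₂) : b.inv x₁ V h₁ = b.inv x₂ V h₂ := by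
  subst e; rfl

/-- **Step (a)**: a class dying under `i^*` is represented by a cocycle whose transition functions REDUCE TO `1` under `i♯` — lift the units
of the coboundary `λ_y = λ_x · i♯G_{xy}` over affine charts (`i♯` is onto there, lifts of units are units) and twist `G` by them.
[cite: Hartshorne1977, III §4, Ex. 4.4–4.5] [cite: Hartshorne2010, §6 proof of Thm. 6.4, p. 50] -/
theorem UnitCocycle.exists_app_eq_one_of_pullback_eq_one (c₁ : UnitCocycle X') (h : CechPic.pullback i (CechPic.mk c₁) = 1) :
    ∃ c : UnitCocycle X', CechPic.mk c = CechPic.mk c₁ ∧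
      ∀ (x y : X') (V : X'.Opens) (hx : V ≤ c.U x) (hy : V ≤ c.U y), i.app V (c.g x y V hx hy) = 1 := by
  classical
  rw [CechPic.pullback_mk, ← CechPic.mk_one, CechPic.mk_eq_mk_iff] at h
  obtain ⟨b⟩ := h
  -- a set-theoretic inverse of the bijection `i`
  have hsurj := i.surjective
  choose σ hσ using hsurj
  have hσi : ∀ x : X, σ (i.base x) = x := fun x => i.isClosedEmbedding.injective (hσ _)
  -- affine charts `A_{x'} ∋ x'` inside `U¹_{x'}` whose preimage lies in the refinement `W_{σ x'}` of the coboundary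
  have hA : ∀ x' : X', ∃ A : X'.affineOpens, x' ∈ A.1 ∧ A.1 ≤ c₁.U x' ∧ i ⁻¹ᵁ A.1 ≤ b.W (σ x') := by
    intro x'
    have h1 : i.base (σ x') ∈ c₁.U x' := by rw [hσ]; exact c₁.mem x'
    obtain ⟨A, hxA, hAU, hAW⟩ := exists_affineOpens_preimage_le i (b.mem (σ x')) h1
    rw [hσ] at hxA
    exact ⟨A, hxA, hAU, hAW⟩
  choose A hAmem hAU hAW using hA
  -- lifts `Λ_{x'}` of the coboundary's units `λ_{σ x'}` over `A_{x'}`; they are units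
  have hΛ : ∀ x' : X', ∃ Λ : Γ(X', (A x').1), i.app (A x').1 Λ = b.lam (σ x') (i ⁻¹ᵁ (A x').1) (hAW x') :=
    fun x' => i.app_surjective _ (A x').2 _
  choose Λ hΛ using hΛ
  have hΛunit : ∀ x', IsUnit (Λ x') := fun x' =>
    isUnit_of_isUnit_app i (A x').2 (by rw [hΛ]; exact IsUnit.of_mul_eq_one _ (b.lam_mul_inv (σ x') _ (hAW x')))
  let Λi : ∀ x' : X', Γ(X', (A x').1) := fun x' => ((hΛunit x').unit⁻¹ : (Γ(X', (A x').1))ˣ)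
  have hΛΛi : ∀ x', Λ x' * Λi x' = 1 := fun x' => (hΛunit x').mul_val_inv
  have hΛi : ∀ x' : X', i.app (A x').1 (Λi x') = b.inv (σ x') (i ⁻¹ᵁ (A x').1) (hAW x') := by
    intro x'
    have h1 : i.app (A x').1 (Λ x') * i.app (A x').1 (Λi x') = 1 := by rw [← map_mul, hΛΛi, map_one]
    rw [hΛ] at h1
    have h2 := b.lam_mul_inv (σ x') _ (hAW x')
    calc i.app (A x').1 (Λi x')
        = b.lam (σ x') _ (hAW x') * b.inv (σ x') _ (hAW x') * i.app (A x').1 (Λi x') := by rw [h2, one_mul]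
      _ = b.inv (σ x') _ (hAW x') * (b.lam (σ x') _ (hAW x') * i.app (A x').1 (Λi x')) := by ring
      _ = b.inv (σ x') _ (hAW x') := by rw [h1, mul_one]
  -- the twisted cocycle `G_{x'y'} := Λ_{x'} G¹_{x'y'} Λ_{y'}⁻¹` on the affine charts
  let c : UnitCocycle X' :=
    { U := fun x' => (A x').1
      mem := hAmem
      g := fun x' y' V hx hy =>
        secRes X' hx (Λ x') * c₁.g x' y' V (hx.trans (hAU x')) (hy.trans (hAU y')) * secRes X' hy (Λi y')
      map_g := fun x' y' V V' hx hy j => by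
        rw [map_mul, map_mul, secRes_secRes, secRes_secRes, c₁.map_g]
      g_mul := fun x' y' z' V hx hy hz => by
        have e : secRes X' hy (Λi y') * secRes X' hy (Λ y') = 1 := by
          rw [← map_mul, mul_comm, hΛΛi, map_one]
        calc secRes X' hx (Λ x') * c₁.g x' y' V _ _ * secRes X' hy (Λi y') *
              (secRes X' hy (Λ y') * c₁.g y' z' V _ _ * secRes X' hz (Λi z'))
            = secRes X' hx (Λ x') * (c₁.g x' y' V (hx.trans (hAU x')) (hy.trans (hAU y')) *
                c₁.g y' z' V (hy.trans (hAU y')) (hz.trans (hAU z'))) * secRes X' hz (Λi z') *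
                (secRes X' hy (Λi y') * secRes X' hy (Λ y')) := by ring
          _ = _ := by rw [c₁.g_mul, e, mul_one]
      g_self := fun x' V hx => by
        rw [c₁.g_self, mul_one, ← map_mul, hΛΛi, map_one] }
  -- `c` is cohomologous to `c₁` via the `Λ`'s
  have hcc : CechPic.mk c = CechPic.mk c₁ := by
    refine (CechPic.sound ⟨{
      W := fun x' => (A x').1
      mem := hAmem
      le := fun x' => hAU x'
      le' := fun x' => le_rfl
      lam := fun x' V h => secRes X' h (Λ x')
      inv := fun x' V h => secRes X' h (Λi x')
      map_lam := fun x' V V' h j => by rw [secRes_secRes]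
      lam_mul_inv := fun x' V h => by rw [← map_mul, hΛΛi, map_one]
      rel := fun x' y' V hx hy => ?_ }⟩).symm
    change secRes X' hx (Λ x') * c₁.g x' y' V _ _ * secRes X' hy (Λi y') * secRes X' hy (Λ y') =
      secRes X' hx (Λ x') * c₁.g x' y' V _ _
    rw [mul_assoc, ← map_mul, mul_comm (Λi y'), hΛΛi, map_one, mul_one]
  refine ⟨c, hcc, fun x' y' V hx hy => ?_⟩
  -- reduce to points of `X`: `x' = i x`, `y' = i y`
  obtain ⟨x, rfl⟩ := i.surjective x'
  obtain ⟨y, rfl⟩ := i.surjective y'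
  have hxW : i ⁻¹ᵁ V ≤ b.W x := by
    have h3 := hAW (i.base x); rw [hσi] at h3; exact (i.preimage_mono hx).trans h3
  have hyW : i ⁻¹ᵁ V ≤ b.W y := by
    have h3 := hAW (i.base y); rw [hσi] at h3; exact (i.preimage_mono hy).trans h3
  change i.app V (secRes X' hx (Λ (i.base x)) * c₁.g (i.base x) (i.base y) V (hx.trans (hAU (i.base x)))
    (hy.trans (hAU (i.base y))) * secRes X' hy (Λi (i.base y))) = 1
  rw [map_mul, map_mul, app_secRes, app_secRes, hΛ, hΛi, b.map_lam, UnitCocycle.Coboundary.map_inv,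
    Coboundary.lam_congr_point b (hσi x) (i ⁻¹ᵁ V) _ hxW, Coboundary.inv_congr_point b (hσi y) (i ⁻¹ᵁ V) _ hyW]
  -- the middle factor is the pulled-back cocycle at `(x, y)` over `i⁻¹ V`
  have e1 : c₁.g (i.base x) (i.base y) V (hx.trans (hAU (i.base x))) (hy.trans (hAU (i.base y))) =
      secRes X' (le_inf (hx.trans (hAU (i.base x))) (hy.trans (hAU (i.base y))))
        (c₁.g (i.base x) (i.base y) _ inf_le_left inf_le_right) :=
    (c₁.map_g (i.base x) (i.base y) inf_le_left inf_le_right _).symm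
  have hmid : i.app V (c₁.g (i.base x) (i.base y) V (hx.trans (hAU (i.base x))) (hy.trans (hAU (i.base y)))) =
      (c₁.pullback i).g x y (i ⁻¹ᵁ V) (hxW.trans (b.le x)) (hyW.trans (b.le y)) := by
    rw [e1, app_secRes, UnitCocycle.pullback_g]
    rfl
  rw [hmid]
  have hrel : (1 : Γ(X, i ⁻¹ᵁ V)) * b.lam y (i ⁻¹ᵁ V) hyW =
      b.lam x (i ⁻¹ᵁ V) hxW * (c₁.pullback i).g x y (i ⁻¹ᵁ V) (hxW.trans (b.le x)) (hyW.trans (b.le y)) :=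
    b.rel x y (i ⁻¹ᵁ V) hxW hyW
  rw [one_mul] at hrel
  rw [← hrel]
  exact b.lam_mul_inv y _ hyW

end Reduction

end Literature.AlgebraicGeometry.Modules

end
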